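import Mathlib
import HarnessLib
import Summits.HubbardSuperconductivity.HubbardSuperconductivity.Theorems.KLProgrammeKLRegimeEngineV8TwoLegSpaceMomentsExportZ
import Summits.HubbardSuperconductivity.HubbardSuperconductivity.Theorems.KLProgrammeKLRegimeEngineTwoLegReadDriverHist

/-!
# K3 gen-8-FLOW (stmt-HubbardSuperconductivity-20437 `KLRegimeEngineV17F2`, stub (C) `stub_twoLeg_curvature`): the (C) one-call's #17-EXPORT family
# `TwoLegDualSpaceMomentsUpToAt L M (klZsp5AtZ … U m) β U μ m 5` at every scale BELOW the history horizon, unrolled from the (X).3 Z-package by strong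
# induction (cell gate-hubbard-kl, seat p2 g24)

The one-calls `twoLegRead_flow_registered_*_u0f(_hist)` take `hZsp : ∀ m, … → TwoLegDualSpaceMomentsUpToAt L M (klZspLaw z U m) β U μ m 5`.  With
`z := klZsp5Z P R Q₀ G` (`klZsp5AtZ … U m = klZspLaw (klZsp5Z …) U m`, `rfl`) this is p1b's Z-layer unroll `twoLegDualSpaceMomentsUpToAt_all_of_existsZ`
(…TwoLegSpaceMomentsExportZ, p669618) run by STRONG INDUCTION over the scales below the horizon: at `m < n` its inputs `HistP … 0 m` (`histP_klPredsV17F2_mono`),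
`FrameOK R U (nScales β) μ K_m` (`frameOK_klFlowFrameU_self_of_hist` + `FrameOK.mono`, `m ≤ n_β`) and `EngineBoundsAtV17F2 … m` (`engineBoundsAtV17F2_of_hist`)
are projections of the history at horizon `n`, and the export history `∀ j < m` is the induction hypothesis:
**`twoLegDualSpaceMomentsUpToAt_below_of_hist`**.  (At the horizon itself the stub's own binder supplies the export.)  Pure composition; nothing asserts
(C), (X), any stub of 20437, K3 or superconductivity.  References: BGM 2006 §2.4 [cite: BenfattoGiulianiMastropietro2006].
-/

noncomputable section

namespace Summit.HubbardSuperconductivity.HubbardSuperconductivity.Theorems.EngineV8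

set_option linter.dupNamespace false -- summit = problem name (single-conjunct summit), D-0017

open Real Finset Literature.MathematicalPhysics.QuantumLattice Literature.Probability.LatticeModels
open Literature.MathematicalPhysics.QuantumLattice.FermiRG
open Summit.HubbardSuperconductivity.HubbardSuperconductivity.Theorems.KLRegimeSplit
open Summit.HubbardSuperconductivity.HubbardSuperconductivity.Theorems.KLProgrammeLegKernels

section Model

variable {L M : ℕ} [NeZero L] [NeZero M] {G : GeoConsts} {P : SplitConsts} {Q Q₀ : EngConsts} {R : RenConsts} {β U μ cc : ℝ} {K : TrigPolyC4v} {n : ℕ}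

/-- The public history restricts to a lower horizon. -/
theorem histP_klPredsV17F2_mono (hhist : HistP klPredsV17F2 L M G P Q R β U μ K n) {m : ℕ} (hm : m ≤ n) :
    HistP klPredsV17F2 L M G P Q R β U μ K m :=
  (histP_klPredsV17F2_iff L M G P Q R β U μ K m).2 fun j hj => (histP_klPredsV17F2_iff L M G P Q R β U μ K n).1 hhist j (lt_of_lt_of_le hj hm)

/-- **THE #17 EXPORT AT EVERY SCALE BELOW THE HORIZON, from the (X).3 Z-package by strong induction**: under the Z-amended (X) conjunct
(`∃ e, IsSpaceMomPkg5Z R e ∧ TwoLegSpaceMomentsStep5 P R Q₀ G e.1 e.2`), the raise `Q₀.IsRaiseOf Q`, the regime/threshold rows of the unroll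
(`0 < cc ≤ klEngC₃6`, `μ ∈ klWindowC`, `0 < U ≤ klEngU₀10 ⊓ klZspU5Z`, `klBetaMin ≤ β ≤ e^{cc/U²}`, `klEngL₄ ≤ L`, `klEngM₃ ≤ M`), `R.WF`, and the public history at
horizon `n ≤ n_β + 1`: `∀ m < n, TwoLegDualSpaceMomentsUpToAt L M (klZsp5AtZ P R Q₀ G U m) β U μ m 5`. -/
theorem twoLegDualSpaceMomentsUpToAt_below_of_hist
    (hex : ∃ e : (ℕ → ℝ) × (EngConsts → ℝ → ℝ), IsSpaceMomPkg5Z R e ∧ TwoLegSpaceMomentsStep5 P R Q₀ G e.1 e.2) (hQ : Q₀.IsRaiseOf Q)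
    (hc : 0 < cc) (hc36 : cc ≤ klEngC₃6 P R) (hμ : μ ∈ klWindowC) (hU : 0 < U) (hU10 : U ≤ klEngU₀10 P R cc) (hUu : U ≤ klZspU5Z P R Q₀ G Q cc)
    (hβ : klBetaMin ≤ β) (hβc : β ≤ Real.exp (cc / U ^ 2)) (hL : klEngL₄ P R β U ≤ L) (hM : klEngM₃ β U L ≤ M) (hRW : R.WF)
    (hn : n ≤ nScales β + 1) (hhist : HistP klPredsV17F2 L M G P Q R β U μ 0 n) :
    ∀ m < n, TwoLegDualSpaceMomentsUpToAt L M (klZsp5AtZ P R Q₀ G U m) β U μ m 5 := by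
  intro m
  induction m using Nat.strong_induction_on with
  | _ m IH =>
    intro hm
    have hmβ : m ≤ nScales β := by omega
    have hfr : FrameOK R U (nScales β) μ (klFlowFrameU L M β U μ m) :=
      FrameOK.mono hRW.2.2 hmβ (frameOK_klFlowFrameU_self_of_hist hhist hRW hμ m hm.le)
    exact twoLegDualSpaceMomentsUpToAt_all_of_existsZ hex hQ hc hc36 hμ hU hU10 hUu hβ hβc hL hM (by omega) (histP_klPredsV17F2_mono hhist hm.le) hfr
      (engineBoundsAtV17F2_of_hist hhist m hm) fun j hj => IH j hj (lt_trans hj hm)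

/-- **The one-call's `hZsp` family in its own shape** (`klZspLaw (klZsp5Z …) U m`, horizon `N + 1 ≤ n`): `∀ m ≤ N, TwoLegDualSpaceMomentsUpToAt … m 5`. -/
theorem zsp_family_of_hist
    (hex : ∃ e : (ℕ → ℝ) × (EngConsts → ℝ → ℝ), IsSpaceMomPkg5Z R e ∧ TwoLegSpaceMomentsStep5 P R Q₀ G e.1 e.2) (hQ : Q₀.IsRaiseOf Q)
    (hc : 0 < cc) (hc36 : cc ≤ klEngC₃6 P R) (hμ : μ ∈ klWindowC) (hU : 0 < U) (hU10 : U ≤ klEngU₀10 P R cc) (hUu : U ≤ klZspU5Z P R Q₀ G Q cc)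
    (hβ : klBetaMin ≤ β) (hβc : β ≤ Real.exp (cc / U ^ 2)) (hL : klEngL₄ P R β U ≤ L) (hM : klEngM₃ β U L ≤ M) (hRW : R.WF)
    (hn : n ≤ nScales β + 1) (hhist : HistP klPredsV17F2 L M G P Q R β U μ 0 n) {N : ℕ} (hN : N + 1 ≤ n) :
    ∀ m, m ≤ N → TwoLegDualSpaceMomentsUpToAt L M (klZspLaw (klZsp5Z P R Q₀ G) U m) β U μ m 5 :=
  fun m hm => twoLegDualSpaceMomentsUpToAt_below_of_hist hex hQ hc hc36 hμ hU hU10 hUu hβ hβc hL hM hRW hn hhist m (by omega)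

end Model

end Summit.HubbardSuperconductivity.HubbardSuperconductivity.Theorems.EngineV8

end
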